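import Summits.QuantumFields.YangMills.Theorems.LocalInsertionSublevelDoublingOneSitePartition
import Summits.QuantumFields.YangMills.Theorems.LocalInsertionExpMomentSU2TorusUniformT3
import HarnessLib

/-!
# The level-0 `SU(2)` plaquette estimates on the 3-torus, `β`- and volume-UNIFORM — UNCONDITIONAL

Crux `HistoryTailL` (stmt-QuantumFields-19936), level-0 lane (T4) «uniform doubling» of the cell `ym3-torus` (rung R3: continuum SU(2)
Yang–Mills on the 3-torus — NOT d = 4, NOT infinite volume, NOT a mass gap, NOT the Clay problem). The night's prefactor-free programme
(LEAD ★w1-19936 g7, T1–T4) was landed MODULO ONE displayed hypothesis `hONE` — the one-site partition-function doubling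
`Z₁(t/4) ≤ K·Z₁(t)` on `SU(2)³` (`…LocalInsertionTorusUniformDoublingSU2D3`, `…LocalInsertionExpMomentSU2TorusUniform`,
`…LocalInsertionExpMomentSU2TorusUniformT3`, w4 g10). That hypothesis is `SublevelDoubling.oneSite_partitionFunction_doubling_su2_d3`
(`…LocalInsertionSublevelDoublingOneSitePartition`: the d-generic conical sublevel doubling + the layer cake). This file records the six
corollaries with `hONE` DISCHARGED — every statement is the conditional one verbatim minus its hypothesis:

* `exists_integral_exp_half_plaquette_su2_le` — the exponential plaquette moment at `λ = ½`: `⟨e^{β φ_p/2}⟩_{(ℤ/n)³,β} ≤ e^{A}`, uniform in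
  `n ≥ 2` even and `β ≥ 4`;
* `exists_measureReal_largePlaquette_su2_le` — the Gaussian plaquette tail `P{θ ≤ ‖U_p − 1‖} ≤ e^{A} e^{−βθ²/4}` under `wilsonMeasure`;
* `exists_gibbsMeasure_real_dist1_ge_le_T3`, `exists_gibbsK_real_dist1_ge_le` — the same in the `T3Family` letters (`gibbsMeasure (F.P K) β`,
  the tower laws `gibbsK F ℰ γ K`, `β ≥ 8`): GOOD-1's per-plaquette input with NO power of `β` and NO power of the volume;
* `exists_integral_dist1_le_T3`, `exists_integral_dist1_gibbsK_le` — (EQ1): `∫ dist1(U(∂p)) ≤ C/√β`, `β`- and `K`-uniform, γ-free constants.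

Three-line compositions; no new mathematics; no definitions.
-/

set_option autoImplicit false

namespace Summit.QuantumFields.YangMills.Theorems.LocalInsertion.LevelZeroUniformSU2T3

open MeasureTheory
open scoped Matrix.Norms.L2Operator
open Literature.MathematicalPhysics.QuantumFieldTheory
open Literature.MathematicalPhysics.QuantumFieldTheory.Balaban1983to89
open Literature.MathematicalPhysics.QuantumFieldTheory.Balaban1983to89.T3ContinuumYM3Torus
open Literature.MathematicalPhysics.QuantumFieldTheory.Balaban1983to89.T3UnitScaleTilt
open Literature.MathematicalPhysics.QuantumLattice (fundamentalRep)
open Summit.QuantumFields.YangMills.Theorems.LocalInsertion.SublevelDoubling (oneSite_partitionFunction_doubling_su2_d3)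
open Summit.QuantumFields.YangMills.Theorems.LocalInsertion.ExpMomentSU2Uniform
open Summit.QuantumFields.YangMills.Theorems.LocalInsertion.ExpMomentSU2UniformT3

noncomputable section

/-- ★ **The exponential plaquette moment at `λ = ½`, UNIFORM in the volume and in `β` — unconditional.** There is `A` such that for every
even `n ≥ 2`, every `β ≥ 4`, every spatial direction `a` and site `c₀` of `(ℤ/n)³`:
`∫ exp(½ β (2 − Re tr U_{c₀;0a})) d(wilsonMeasure ρ β) ≤ e^{A}` (`ρ` the fundamental representation of `SU(2)`). The door
(`PlaquetteExpMoment.integral_exp_mul_plaquette_le_of_sandwich`) fed by the unconditional torus doubling `SublevelDoubling.uniformDoubling_su2_d3`. -/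
theorem exists_integral_exp_half_plaquette_su2_le :
    ∃ A : ℝ, ∀ (n : ℕ) [NeZero n] (β : ℝ), 2 ≤ n → Even n → 4 ≤ β →
      ∀ {a : Fin 3}, (0 : Fin 3) < a → ∀ c₀ : Site 3 n,
        ∫ U, Real.exp (1 / 2 * β * (((2 : ℕ) : ℝ) -
            ((fundamentalRep (Fin 2)) (plaquetteHolonomy U c₀ 0 a)).trace.re))
          ∂(wilsonMeasure (fundamentalRep (Fin 2)) β) ≤ Real.exp A :=
  exists_integral_exp_half_plaquette_su2_le_of_oneSiteDoubling oneSite_partitionFunction_doubling_su2_d3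

/-- ★ **The Gaussian plaquette tail under the Wilson measure on `(ℤ/n)³`, UNIFORM — unconditional:**
`P{θ ≤ ‖ρ(U_{c₀;0a}) − 1‖} ≤ e^{A} · exp(−(½ β θ²/2))` for even `n ≥ 2`, `β ≥ 4`, `θ ≥ 0`. -/
theorem exists_measureReal_largePlaquette_su2_le :
    ∃ A : ℝ, ∀ (n : ℕ) [NeZero n] (β : ℝ), 2 ≤ n → Even n → 4 ≤ β →
      ∀ {a : Fin 3}, (0 : Fin 3) < a → ∀ (c₀ : Site 3 n) {θ : ℝ}, 0 ≤ θ →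
        (wilsonMeasure (fundamentalRep (Fin 2)) β).real
            {U : GaugeConfig 3 n (Matrix.specialUnitaryGroup (Fin 2) ℂ) |
              θ ≤ ‖(fundamentalRep (Fin 2)) (plaquetteHolonomy U c₀ 0 a) - 1‖} ≤
          Real.exp A * Real.exp (-(1 / 2 * β * θ ^ 2 / 2)) :=
  exists_measureReal_largePlaquette_su2_le_of_oneSiteDoubling oneSite_partitionFunction_doubling_su2_d3

/-- ★★ **GOOD-1's per-plaquette input, `β`-UNIFORM, in the `T3Family` letters — unconditional:** there is `A` with, for every `T3Family F`,
cut-off `K`, coupling `β ≥ 8`, `θ ≥ 0` and plaquette `p` of `T^{(0)}_K`,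
`(gibbsMeasure (F.P K) β).real {U | θ ≤ dist1 (U(∂p))} ≤ e^{A} · exp(−(½ (β/2) θ²/2))` — no power of `β`, no power of the volume. -/
theorem exists_gibbsMeasure_real_dist1_ge_le_T3 :
    ∃ A : ℝ, ∀ (F : T3Family) (K : ℕ) (β : ℝ), 8 ≤ β → ∀ (θ : ℝ), 0 ≤ θ → ∀ p : Plaq (F.P K) 0,
      (T4GenFunBounds.gibbsMeasure (F.P K) β).real
          {U : GaugeField (F.P K) 0 (Matrix.specialUnitaryGroup (Fin 2) ℂ) | θ ≤ dist1 (GaugeField.plaqHol U p)} ≤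
        Real.exp A * Real.exp (-(1 / 2 * (β / 2) * θ ^ 2 / 2)) :=
  exists_gibbsMeasure_real_dist1_ge_le_uniform_T3 oneSite_partitionFunction_doubling_su2_d3

/-- ★★ **The same for the tower laws `gibbsK F ℰ γ K` at `β = β_K` — unconditional** (γ enters only through `8 ≤ β_K`; the constant `A`
is γ-FREE). -/
theorem exists_gibbsK_real_dist1_ge_le :
    ∃ A : ℝ, ∀ (F : T3Family) (ℰ : LoopAverage (Matrix.specialUnitaryGroup (Fin 2) ℂ)) (γ : ℝ) (K : ℕ),
      8 ≤ (F.scheme ℰ γ).β K → ∀ (θ : ℝ), 0 ≤ θ → ∀ p : Plaq (F.P K) 0,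
        (gibbsK F ℰ γ K).real
            {U : GaugeField (F.P K) 0 (Matrix.specialUnitaryGroup (Fin 2) ℂ) | θ ≤ dist1 (GaugeField.plaqHol U p)} ≤
          Real.exp A * Real.exp (-(1 / 2 * ((F.scheme ℰ γ).β K / 2) * θ ^ 2 / 2)) :=
  exists_gibbsK_real_dist1_ge_le_uniform oneSite_partitionFunction_doubling_su2_d3

/-- ★★ **(EQ1), `β`-UNIFORM — unconditional:** `∃ C, ∀ F K β, 8 ≤ β → ∀ p, ∫ dist1(U(∂p)) d(gibbsMeasure (F.P K) β) ≤ C/√β` (the true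
Gaussian scale; layer cake over the uniform tail). -/
theorem exists_integral_dist1_le_T3 :
    ∃ C : ℝ, ∀ (F : T3Family) (K : ℕ) (β : ℝ), 8 ≤ β → ∀ p : Plaq (F.P K) 0,
      ∫ U : GaugeField (F.P K) 0 (Matrix.specialUnitaryGroup (Fin 2) ℂ), dist1 (GaugeField.plaqHol U p)
        ∂(T4GenFunBounds.gibbsMeasure (F.P K) β) ≤ C / Real.sqrt β :=
  exists_integral_dist1_le_uniform_T3 oneSite_partitionFunction_doubling_su2_d3

/-- ★★ **(EQ1) for the tower laws `gibbsK`, γ-FREE constant — unconditional:**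
`∃ C, ∀ F ℰ γ K, 8 ≤ β_K → ∀ p, ∫ dist1(U(∂p)) d(gibbsK F ℰ γ K) ≤ C/√β_K`. -/
theorem exists_integral_dist1_gibbsK_le :
    ∃ C : ℝ, ∀ (F : T3Family) (ℰ : LoopAverage (Matrix.specialUnitaryGroup (Fin 2) ℂ)) (γ : ℝ) (K : ℕ),
      8 ≤ (F.scheme ℰ γ).β K → ∀ p : Plaq (F.P K) 0,
        ∫ U, dist1 (GaugeField.plaqHol U p) ∂(gibbsK F ℰ γ K) ≤ C / Real.sqrt ((F.scheme ℰ γ).β K) :=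
  exists_integral_dist1_gibbsK_le_uniform oneSite_partitionFunction_doubling_su2_d3

end

end Summit.QuantumFields.YangMills.Theorems.LocalInsertion.LevelZeroUniformSU2T3
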